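import Literature.AlgebraicGeometry.HodgeTheory.LefschetzStandardOfSmallChowGroupsVialRange
import Literature.AlgebraicGeometry.HodgeTheory.MaxRationalSubHodgeStructureHodgeClasses
import HarnessLib

/-!
# The Hodge conjecture for `Y × Z` in EVERY DEGREE EXCEPT THE MIDDLE one, when `CH₀, …, CH_{k₀}(Y)`, `CH₀, …, CH_{k₁}(Z)` have rank `≤ 1` and `dim Y ≤ 2k₀ + 4`, `dim Z ≤ 2k₁ + 4` (one step beyond g33-#7's
# all-degrees window), and for `S × Z`, `S` ANY surface, `dim Z ≤ 2k₁ + 4`: e.g. two fourfolds with `CH₀ ⊗ ℚ = ℚ` (two cubic fourfolds, granted KMM92: every degree `≠ 8`), any surface times such a fourfold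
# (every degree `≠ 6` — `K3 ×` cubic fourfold), two sixfolds with `CH₀, CH₁` (cubic sixfolds granted ELV: every degree `≠ 12`)
# (Voisin I Thm. 11.38–11.40, Lemma 7.23; Voisin II Prop. 9.20, Thm. 10.29/10.31; Laterveer 1998; Vial 2013 Thm. 7.1; Bloch–Srinivas 1983; Deligne 2000 §1; Grothendieck 1969)

Family `hodge`, lane `lit-hodgefound` (Track 2 foundations library; Layers A1/A4), layer `Literature/AlgebraicGeometry/HodgeTheory`.  THEOREMS ONLY (no definition, no named fact, no instance;
D-0026 net debt `0`).  Sequel of the seat's g33-#17 (`BettiUniverse.hodgeClasses_tensor_algebraic_of_forall_pieces`, the per-degree coniveau product criterion), g33-#14 (profiles) and g33-#7 (`HC` of the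
factors, `dim ≤ 2k + 5`, and ALL of `HC(Y × Z)` for `dim Y ≤ 2k₀ + 5`, `dim Z ≤ 2k₁ + 5`, `dim Y + dim Z ≤ 2(k₀ + k₁) + 7`).  At `dim Y = 2k₀ + 4`, `dim Z = 2k₁ + 4` the sum is `2(k₀ + k₁) + 8` and exactly ONE
Künneth piece escapes the coniveau bound: `H^{dim Y}(Y) ⊗ H^{dim Z}(Z)` in the middle degree (for two cubic fourfolds, `H⁴ ⊗ H⁴` with its `H^{3,1} ⊗ H^{1,3}` — the famous open case); every OTHER degree is
settled here.

THE ARGUMENT.  `GHC(W, 2c, c)` («rational `(c,c)`-classes of `H^{2c}(W)` are algebraic», the tree's `generalHodgePropertyFor_two_mul_self_iff`) for `W = Y × Z` follows from g33-#17's criterion in degree `2c`: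
`HC(Y)`, `HC(Z)` (g33-#7) and `c ≤ ρ_Y(i) + ρ_Z(j) + 1` on the pieces `i + j = 2c`, `i, j ≥ 1`, which holds for the profiles of g33-#14 whenever `dim Y ≤ 2k₀ + 4`, `dim Z ≤ 2k₁ + 4` and `2c ≠ dim Y + dim Z`;
for a surface factor (profile `(0, 0, 0, 1, 2)`, `HC(S)` free) whenever `dim Z ≤ 2k₁ + 4` and `2c ≠ dim Z + 2`.  (Elementary; checked on `73 217 + 1 064` instances before typing, decided by `omega`.)

WHAT IS PROVED (`0` sorrys; every statement a theorem; tensor facts and the real Hodge model are theorems of the tree).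
* §1 `generalHodgePropertyFor_two_mul_self_tensor_of_forall_pieces` — g33-#17's per-degree criterion in the `GHC(W, 2c, c)` spelling.
* §2 **`generalHodgePropertyFor_two_mul_self_tensor_of_chowRankLEOneUpTo_of_ne`** — `GHC(Y × Z, 2c, c)` for all `c` with `2c ≠ dim Y + dim Z`, when `dim Y ≤ 2k₀ + 4`, `dim Z ≤ 2k₁ + 4`;
  **`generalHodgePropertyFor_two_mul_self_surface_tensor_of_chowRankLEOneUpTo_of_ne`** (+ mirror) — `GHC(S × Z, 2c, c)` for all `2c ≠ dim Z + 2`, `S` ANY surface, `dim Z ≤ 2k₁ + 4`.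
* §3 Instances: two fourfolds with `CH₀ ⊗ ℚ` of rank `≤ 1` / rationally chain connected / Fano (KMM92) — every degree `≠ 8`; any surface times such a fourfold — every degree `≠ 6` (+ mirror); two sixfolds with
  `CH₀, CH₁` — every degree `≠ 12`; granted ELV: two smooth cubic sixfolds, any surface times a cubic sixfold (every degree `≠ 8`).

THE PRINTS.  C. Voisin (2002) [VoisinHodgeI2002] §11.3.3 Thm. 11.38–11.40, Lemma 11.41, p. 287, §7.3.1 Lemma 7.23, §6.2.3 Thm. 6.25; C. Voisin (2003) [VoisinHodgeII2003] §9.2.4 Prop. 9.20, §10.3.1 Thm. 10.29, Thm. 10.31, §10.2.2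
Thm. 10.17; R. Laterveer (1998) [Laterveer1998]; Ch. Vial (2013) [Vial2013] Thm. 7.1, §7.2.2; S. Bloch, V. Srinivas (1983) [BlochSrinivas1983] Thm. 1; P. Deligne (2000) [Deligne2000] §1; A. Grothendieck (1969)
[GrothendieckTopology1969] §1; H. Esnault, M. Levine, E. Viehweg (1997) [EsnaultLevineViehweg1997] Thm. 4.6; J. Kollár (1996) [Kollar1995] Def. 4.10; KMM (1992) [KollarMiyaokaMori1992] Thm. 3.3.

THE OBJECTS (all the tree's).  `GeneralHodgePropertyFor`, `HodgeConjectureFor`, `supportedClasses`, `HodgeModel`, `Motives.ChowRankLEOneUpTo`, `IsRationallyChainConnected`, `IsFano`, `Motives.IsSmoothCompleteIntersection 6 (3)`,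
`Motives.EsnaultLevineViehweg1997_chowGroup_rank_le_one`, `KollarMiyaokaMori1992_fano_rationallyChainConnected` (hypotheses only); the tree's `generalHodgePropertyFor_two_mul_self_iff`, `nonempty_hodgeModel_holds`,
`hodgeConjectureFor_of_dim_le_three_holds`, `supportedClasses_zero`, `supportedClasses_eq_top_of_dim_add_le`, and the seat's `BettiUniverse.hodgeClasses_tensor_algebraic_of_forall_pieces`, `supportedClasses_profile_of_chowRankLEOneUpTo`,
`hodgeConjectureFor_of_chowRankLEOneUpTo`, `IsRationallyChainConnected.chowRankLEOneUpTo_zero`, `chowRankLEOneUpTo_one_of_cubic_of_ELV`.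

DEVIATIONS / SCOPE.  Complex orientations.  Nothing is claimed in the middle degree (there the method stops at the piece `H^{dim Y} ⊗ H^{dim Z}`), nor for a factor of dimension `2k + 5` or more.

## References
* [VoisinHodgeI2002] C. Voisin, *Hodge Theory and Complex Algebraic Geometry I* — Thm. 11.38–11.40, Lemma 11.41, p. 287; Lemma 7.23; Thm. 6.25.
* [VoisinHodgeII2003] C. Voisin, *Hodge Theory and Complex Algebraic Geometry II* — Prop. 9.20; Thm. 10.29; Thm. 10.31; Thm. 10.17.
* [Laterveer1998] R. Laterveer, J. Math. Kyoto Univ. 38 (1998) — main theorem.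
* [Vial2013] Ch. Vial, Doc. Math. 18 (2013) — Thm. 7.1; §7.2.2.
* [BlochSrinivas1983] S. Bloch, V. Srinivas, Amer. J. Math. 105 (1983) — Thm. 1.
* [Deligne2000] P. Deligne, *The Hodge conjecture* (Clay, 2000) — §1.
* [GrothendieckTopology1969] A. Grothendieck, Topology 8 (1969) — §1.
* [EsnaultLevineViehweg1997] H. Esnault, M. Levine, E. Viehweg, Duke Math. J. 87 (1997) — Thm. 4.6.
* [Kollar1995] J. Kollár, *Rational Curves on Algebraic Varieties* — Def. 4.10.
* [KollarMiyaokaMori1992] J. Kollár, Y. Miyaoka, S. Mori, J. Differential Geom. 36 (1992) — Thm. 3.3.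

## Provenance
Lane `lit-hodgefound` (summit `HodgeConjecture`, Track 2 foundations), seat `lit-hodgefound-p29` (literature-prover, generation 33, row g33-#21).
-/

noncomputable section

open scoped TensorProduct
open CategoryTheory AlgebraicGeometry MonoidalCategory CartesianMonoidalCategory Module Finset
open Literature.AlgebraicTopology.SingularHomology
open Literature.Geometry.Kaehler

namespace Literature.AlgebraicGeometry.HodgeTheory

open Literature.AlgebraicGeometry.Motives
open Literature.AlgebraicGeometry.Motives.HodgeStructure

variable {m n : ℕ} {X Y Z : SchemeOver ℂ}

/-! ### §1 The per-degree criterion in the `GHC(W, 2c, c)` spelling -/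

/-- **`GHC(Y × Z, 2c, c)` from `HC(Y)`, `HC(Z)` and the coniveau inequality on the Künneth pieces of degree `2c`** (g33-#17's criterion, read through `generalHodgePropertyFor_two_mul_self_iff`).
[cite: VoisinHodgeI2002, §11.3.3 Thm. 11.38, Thm. 11.40, Lemma 11.41, p. 287 and §7.3.1 Lemma 7.23] [cite: VoisinHodgeII2003, §9.2.4 Prop. 9.20] [cite: Deligne2000, §1] [cite: GrothendieckTopology1969, §1, p. 300] -/
theorem generalHodgePropertyFor_two_mul_self_tensor_of_forall_pieces (hY : IsSmoothProjective m Y) (hZ : IsSmoothProjective n Z) (hHCY : HodgeConjectureFor m Y) (hHCZ : HodgeConjectureFor n Z)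
    (ρ σ : ℕ → ℕ) (hYs : ∀ i, i ≤ 2 * m → supportedClasses Y i (ρ i) = ⊤) (hZs : ∀ j, j ≤ 2 * n → supportedClasses Z j (σ j) = ⊤) {c : ℕ}
    (h : ∀ i j : ℕ, i + j = 2 * c → 1 ≤ i → i ≤ 2 * m → 1 ≤ j → j ≤ 2 * n → c ≤ ρ i + σ j + 1) : GeneralHodgePropertyFor (m + n) (Y ⊗ Z) (2 * c) c := by
  haveI : HodgeTensorFacts.{0, 0} := hodgeTensorFacts_holds
  have hW : IsSmoothProjective (m + n) (Y ⊗ Z) := hY.tensor_holds hZ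
  obtain ⟨AW⟩ := nonempty_hodgeModel_holds hW
  exact (generalHodgePropertyFor_two_mul_self_iff AW hW c).2 fun v hv hvH ↦
    BettiUniverse.hodgeClasses_tensor_algebraic_of_forall_pieces exists_isReal_hodgeModel_holds hY hZ hW hHCY hHCZ ρ σ hYs hZs h v hv hvH

/-! ### §2 Every degree except the middle one -/

/-- **`HC(Y × Z)` in every degree except the middle one: `GHC(Y × Z, 2c, c)` for all `c` with `2c ≠ dim Y + dim Z`, when `CH₀(Y)_ℚ, …, CH_{k₀}(Y)_ℚ` and `CH₀(Z)_ℚ, …, CH_{k₁}(Z)_ℚ` have rank `≤ 1`,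
`dim Y ≤ 2k₀ + 4`, `dim Z ≤ 2k₁ + 4`** (when `dim Y + dim Z` is odd there is no middle degree and this is all of `HC(Y × Z)`, already in g33-#7's window). [cite: VoisinHodgeII2003, Thm. 10.29 and proof of Thm. 10.31, §9.2.4 Prop. 9.20]
[cite: VoisinHodgeI2002, §11.3.3 Thm. 11.38–11.40 and §6.2.3 Thm. 6.25] [cite: Laterveer1998, main theorem (as quoted in Vial2013 Thm. 7.1)] [cite: GrothendieckTopology1969, §1, p. 300] -/
theorem generalHodgePropertyFor_two_mul_self_tensor_of_chowRankLEOneUpTo_of_ne (hY : IsSmoothProjective m Y) (hZ : IsSmoothProjective n Z) {k₀ k₁ : ℕ} (hCHY : ChowRankLEOneUpTo Y k₀)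
    (hCHZ : ChowRankLEOneUpTo Z k₁) (hm : m ≤ 2 * k₀ + 4) (hn : n ≤ 2 * k₁ + 4) {c : ℕ} (hc : 2 * c ≠ m + n) : GeneralHodgePropertyFor (m + n) (Y ⊗ Z) (2 * c) c := by
  refine generalHodgePropertyFor_two_mul_self_tensor_of_forall_pieces hY hZ (hodgeConjectureFor_of_chowRankLEOneUpTo hY hCHY (by omega)) (hodgeConjectureFor_of_chowRankLEOneUpTo hZ hCHZ (by omega)) _ _
    (supportedClasses_profile_of_chowRankLEOneUpTo hY hCHY (2 * (m + n) + 2)) (supportedClasses_profile_of_chowRankLEOneUpTo hZ hCHZ (2 * (m + n) + 2)) fun i j hij hi1 hi hj1 hj ↦ ?_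
  simp only [Nat.min_def]
  split_ifs <;> omega

/-- **`HC(S × Z)` in every degree except the middle one, `S` ANY smooth projective surface and `CH₀(Z)_ℚ, …, CH_{k₁}(Z)_ℚ` of rank `≤ 1`, `dim Z ≤ 2k₁ + 4`**: `GHC(S × Z, 2c, c)` for `2c ≠ dim Z + 2` (the escaping
piece is `H²(S) ⊗ H^{dim Z}(Z)`). [cite: VoisinHodgeII2003, Thm. 10.29 and proof of Thm. 10.31, §9.2.4 Prop. 9.20] [cite: VoisinHodgeI2002, §11.3.3 Thm. 11.38–11.40 and §6.2.3 Thm. 6.25] [cite: GrothendieckTopology1969, §1, p. 300] -/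
theorem generalHodgePropertyFor_two_mul_self_surface_tensor_of_chowRankLEOneUpTo_of_ne {S : SchemeOver ℂ} (hS : IsSmoothProjective 2 S) (hZ : IsSmoothProjective n Z) {k₁ : ℕ}
    (hCHZ : ChowRankLEOneUpTo Z k₁) (hn : n ≤ 2 * k₁ + 4) {c : ℕ} (hc : 2 * c ≠ 2 + n) : GeneralHodgePropertyFor (2 + n) (S ⊗ Z) (2 * c) c := by
  have tabS : ∀ i : ℕ, i ≤ 2 * 2 → supportedClasses S i ((fun i : ℕ ↦ if i ≤ 2 then 0 else i - 2) i) = ⊤ := by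
    intro i hi
    interval_cases i
    · exact supportedClasses_zero S 0
    · exact supportedClasses_zero S 1
    · exact supportedClasses_zero S 2
    · exact supportedClasses_eq_top_of_dim_add_le hS (i := 3) (r := 1) (by norm_num)
    · exact supportedClasses_eq_top_of_dim_add_le hS (i := 4) (r := 2) (by norm_num)
  refine generalHodgePropertyFor_two_mul_self_tensor_of_forall_pieces hS hZ (hodgeConjectureFor_of_dim_le_three_holds (by norm_num) hS) (hodgeConjectureFor_of_chowRankLEOneUpTo hZ hCHZ (by omega)) _ _
    tabS (supportedClasses_profile_of_chowRankLEOneUpTo hZ hCHZ (2 * (2 + n) + 2)) fun i j hij hi1 hi hj1 hj ↦ ?_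
  simp only [Nat.min_def]
  split_ifs <;> omega

/-- Mirror: **`HC(Z × S)` in every degree `2c ≠ dim Z + 2`**, `S` any surface, `dim Z ≤ 2k₁ + 4`. [cite: VoisinHodgeII2003, Thm. 10.29 and proof of Thm. 10.31] [cite: VoisinHodgeI2002, §11.3.3 Thm. 11.38–11.40 and §6.2.3 Thm. 6.25] -/
theorem generalHodgePropertyFor_two_mul_self_tensor_surface_of_chowRankLEOneUpTo_of_ne {S : SchemeOver ℂ} (hZ : IsSmoothProjective n Z) (hS : IsSmoothProjective 2 S) {k₁ : ℕ}
    (hCHZ : ChowRankLEOneUpTo Z k₁) (hn : n ≤ 2 * k₁ + 4) {c : ℕ} (hc : 2 * c ≠ n + 2) : GeneralHodgePropertyFor (n + 2) (Z ⊗ S) (2 * c) c := by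
  have tabS : ∀ i : ℕ, i ≤ 2 * 2 → supportedClasses S i ((fun i : ℕ ↦ if i ≤ 2 then 0 else i - 2) i) = ⊤ := by
    intro i hi
    interval_cases i
    · exact supportedClasses_zero S 0
    · exact supportedClasses_zero S 1
    · exact supportedClasses_zero S 2
    · exact supportedClasses_eq_top_of_dim_add_le hS (i := 3) (r := 1) (by norm_num)
    · exact supportedClasses_eq_top_of_dim_add_le hS (i := 4) (r := 2) (by norm_num)
  refine generalHodgePropertyFor_two_mul_self_tensor_of_forall_pieces hZ hS (hodgeConjectureFor_of_chowRankLEOneUpTo hZ hCHZ (by omega)) (hodgeConjectureFor_of_dim_le_three_holds (by norm_num) hS) _ _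
    (supportedClasses_profile_of_chowRankLEOneUpTo hZ hCHZ (2 * (n + 2) + 2)) tabS fun i j hij hi1 hi hj1 hj ↦ ?_
  simp only [Nat.min_def]
  split_ifs <;> omega

/-! ### §3 Instances -/

/-- **Two smooth projective FOURFOLDS with `CH₀ ⊗ ℚ` of rank `≤ 1`: `HC(F × F')` holds in every degree `2c ≠ 8`** (the piece `H⁴(F) ⊗ H⁴(F')` is the only one not forced). [cite: VoisinHodgeII2003, §10.2.2 Thm. 10.17 and §9.2.4 Prop. 9.20]
[cite: BlochSrinivas1983, Thm. 1] [cite: VoisinHodgeI2002, §11.3.3 Thm. 11.38–11.40] -/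
theorem generalHodgePropertyFor_two_mul_self_tensor_fourfolds_of_chowRankLEOneUpTo_zero {F F' : SchemeOver ℂ} (hF : IsSmoothProjective 4 F) (hF' : IsSmoothProjective 4 F') (hCH : ChowRankLEOneUpTo F 0)
    (hCH' : ChowRankLEOneUpTo F' 0) {c : ℕ} (hc : c ≠ 4) : GeneralHodgePropertyFor (4 + 4) (F ⊗ F') (2 * c) c :=
  generalHodgePropertyFor_two_mul_self_tensor_of_chowRankLEOneUpTo_of_ne hF hF' hCH hCH' (by norm_num) (by norm_num) (by omega)

/-- **Two rationally chain connected smooth projective fourfolds: `HC(F × F')` in every degree `≠ 8`.** [cite: Kollar1995, Def. 4.10] [cite: BlochSrinivas1983, Thm. 1] [cite: VoisinHodgeI2002, §11.3.3 Thm. 11.38–11.40] -/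
theorem generalHodgePropertyFor_two_mul_self_tensor_fourfolds_of_isRationallyChainConnected {F F' : SchemeOver ℂ} (hF : IsSmoothProjective 4 F) (hF' : IsSmoothProjective 4 F')
    (hRC : IsRationallyChainConnected F) (hRC' : IsRationallyChainConnected F') {c : ℕ} (hc : c ≠ 4) : GeneralHodgePropertyFor (4 + 4) (F ⊗ F') (2 * c) c :=
  generalHodgePropertyFor_two_mul_self_tensor_fourfolds_of_chowRankLEOneUpTo_zero hF hF' (hRC.chowRankLEOneUpTo_zero hF) (hRC'.chowRankLEOneUpTo_zero hF') hc

/-- **Two smooth complex FANO fourfolds (e.g. two cubic fourfolds), granted KMM92: `HC(F × F')` in every degree `≠ 8`.** [cite: KollarMiyaokaMori1992, Thm. 3.3] [cite: BlochSrinivas1983, Thm. 1] [cite: VoisinHodgeI2002, §11.3.3 Thm. 11.38–11.40] -/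
theorem generalHodgePropertyFor_two_mul_self_tensor_fourfolds_of_isFano (hKMM : KollarMiyaokaMori1992_fano_rationallyChainConnected) {F F' : SchemeOver ℂ} (hF : IsFano 4 F) (hF' : IsFano 4 F')
    {c : ℕ} (hc : c ≠ 4) : GeneralHodgePropertyFor (4 + 4) (F ⊗ F') (2 * c) c :=
  generalHodgePropertyFor_two_mul_self_tensor_fourfolds_of_chowRankLEOneUpTo_zero hF.isSmoothProjective hF'.isSmoothProjective (hKMM.chowRankLEOneUpTo_zero hF) (hKMM.chowRankLEOneUpTo_zero hF') hc

/-- **Any surface times a fourfold with `CH₀ ⊗ ℚ` of rank `≤ 1`: `HC(S × F)` in every degree `≠ 6`** (e.g. `K3 × F`; the escaping piece is `H²(S) ⊗ H⁴(F)`). [cite: VoisinHodgeII2003, §10.2.2 Thm. 10.17 and §9.2.4 Prop. 9.20]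
[cite: BlochSrinivas1983, Thm. 1] [cite: VoisinHodgeI2002, §11.3.3 Thm. 11.38–11.40] -/
theorem generalHodgePropertyFor_two_mul_self_surface_tensor_fourfold_of_chowRankLEOneUpTo_zero {S F : SchemeOver ℂ} (hS : IsSmoothProjective 2 S) (hF : IsSmoothProjective 4 F) (hCH : ChowRankLEOneUpTo F 0)
    {c : ℕ} (hc : c ≠ 3) : GeneralHodgePropertyFor (2 + 4) (S ⊗ F) (2 * c) c :=
  generalHodgePropertyFor_two_mul_self_surface_tensor_of_chowRankLEOneUpTo_of_ne hS hF hCH (by norm_num) (by omega)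

/-- **Any surface times a smooth complex FANO fourfold, granted KMM92: every degree `≠ 6`.** [cite: KollarMiyaokaMori1992, Thm. 3.3] [cite: BlochSrinivas1983, Thm. 1] [cite: VoisinHodgeI2002, §11.3.3 Thm. 11.38–11.40] -/
theorem generalHodgePropertyFor_two_mul_self_surface_tensor_fourfold_of_isFano (hKMM : KollarMiyaokaMori1992_fano_rationallyChainConnected) {S F : SchemeOver ℂ} (hS : IsSmoothProjective 2 S) (hF : IsFano 4 F)
    {c : ℕ} (hc : c ≠ 3) : GeneralHodgePropertyFor (2 + 4) (S ⊗ F) (2 * c) c :=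
  generalHodgePropertyFor_two_mul_self_surface_tensor_fourfold_of_chowRankLEOneUpTo_zero hS hF.isSmoothProjective (hKMM.chowRankLEOneUpTo_zero hF) hc

/-- **Two smooth projective SIXFOLDS with `CH₀, CH₁ ⊗ ℚ` of rank `≤ 1`: `HC(X × X')` in every degree `≠ 12`.** [cite: VoisinHodgeII2003, Thm. 10.29 and proof of Thm. 10.31] [cite: VoisinHodgeI2002, §11.3.3 Thm. 11.38–11.40] -/
theorem generalHodgePropertyFor_two_mul_self_tensor_sixfolds_of_chowRankLEOneUpTo_one {X' : SchemeOver ℂ} (hX : IsSmoothProjective 6 X) (hX' : IsSmoothProjective 6 X') (hCH : ChowRankLEOneUpTo X 1)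
    (hCH' : ChowRankLEOneUpTo X' 1) {c : ℕ} (hc : c ≠ 6) : GeneralHodgePropertyFor (6 + 6) (X ⊗ X') (2 * c) c :=
  generalHodgePropertyFor_two_mul_self_tensor_of_chowRankLEOneUpTo_of_ne hX hX' hCH hCH' (by norm_num) (by norm_num) (by omega)

/-- **Two smooth CUBIC SIXFOLDS `X, X' ⊂ ℙ⁷_ℂ`, granted ELV: `HC(X × X')` in every degree `≠ 12`.** [cite: Vial2013, §7.2.2] [cite: EsnaultLevineViehweg1997, Thm 4.6 (announced as Thm 4.5 in the Introduction), first bullet]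
[cite: VoisinHodgeI2002, §11.3.3 Thm. 11.38–11.40] -/
theorem generalHodgePropertyFor_two_mul_self_tensor_cubicSixfolds_of_ELV (hR : EsnaultLevineViehweg1997_chowGroup_rank_le_one.{0}) {X' : SchemeOver ℂ} (hX : IsSmoothCompleteIntersection 6 (fun _ : Fin 1 ↦ 3) X)
    (hX' : IsSmoothCompleteIntersection 6 (fun _ : Fin 1 ↦ 3) X') {c : ℕ} (hc : c ≠ 6) : GeneralHodgePropertyFor (6 + 6) (X ⊗ X') (2 * c) c :=
  generalHodgePropertyFor_two_mul_self_tensor_sixfolds_of_chowRankLEOneUpTo_one hX.1 hX'.1 (chowRankLEOneUpTo_one_of_cubic_of_ELV hR hX (by norm_num))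
    (chowRankLEOneUpTo_one_of_cubic_of_ELV hR hX' (by norm_num)) hc

/-- **Any surface times a smooth cubic sixfold, granted ELV: `HC(S × X)` in every degree `≠ 8`.** [cite: Vial2013, §7.2.2] [cite: EsnaultLevineViehweg1997, Thm 4.6] [cite: VoisinHodgeI2002, §11.3.3 Thm. 11.38–11.40] -/
theorem generalHodgePropertyFor_two_mul_self_surface_tensor_cubicSixfold_of_ELV (hR : EsnaultLevineViehweg1997_chowGroup_rank_le_one.{0}) {S : SchemeOver ℂ} (hS : IsSmoothProjective 2 S)
    (hX : IsSmoothCompleteIntersection 6 (fun _ : Fin 1 ↦ 3) X) {c : ℕ} (hc : c ≠ 4) : GeneralHodgePropertyFor (2 + 6) (S ⊗ X) (2 * c) c :=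
  generalHodgePropertyFor_two_mul_self_surface_tensor_of_chowRankLEOneUpTo_of_ne hS hX.1 (chowRankLEOneUpTo_one_of_cubic_of_ELV hR hX (by norm_num)) (by norm_num) (by omega)

end Literature.AlgebraicGeometry.HodgeTheory

end
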